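import Literature.AnabelianGeometry.SemiGraphs.SurfaceTypeModels
import Literature.AnabelianGeometry.SemiGraphs.SurfaceTypeEdgeGroups
import Literature.AnabelianGeometry.SemiGraphs.SurfaceTypeSubCoverticial
import HarnessLib

/-!
# Semi-graphs of anabelioids of surface type over an ARBITRARY decorated semi-graph
([SemiAnbd] Example 2.10, combinatorial form of the second assertion)

Mochizuki, *Semi-graphs of anabelioids*, Publ. RIMS **42** (2006) 221–322, Example 2.10 p. 31
[cite: MochizukiSemiAnbd2006, Ex. 2.10 p.31]: the semi-graph of anabelioids of a pointed stable curve
is of surface type — irreducible components `v` ↦ vertices with `Π_v` the pro-`Σ` fundamental group of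
`v` minus nodes and marked points (a pro-`Σ` completion of some hyperbolic `Γ_{g_v,r_v}`), nodes and
marked points ↦ edges with group `Ẑ^Σ`, each branch at `v` attached through the inertia group of a
DISTINCT cusp of `v`.  The algebraic geometry (stable curves, specialisation of `π₁`) is not in the
tree; this proof-only file proves the COMBINATORIAL content in full generality.  Given

* any semi-graph `𝔾` (the dual semi-graph),
* for each vertex `v` a hyperbolic type `(g_v, r_v)`, a profinite group `P_v` and a pro-`Σ` completion
  `ι_v : Γ_{g_v,r_v} → P_v`,
* a profinite group `Z` with a pro-`Σ` completion `κ : ℤ → Z` (a copy of `Ẑ^Σ`),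
* for each vertex an INJECTIVE assignment `js_v : {branches at v} → Fin r_v` of cusps to branches,

there are attaching maps `att_{v,j} : Z ⥲ Ī_{v,j} ⊆ P_v` onto the closed cusp inertia groups
(`exists_cuspAttachment`; `SurfaceTypeEdgeGroups`: `Ī_{v,j}` is a pro-`Σ` completion of `ℤ`, unique up
to isomorphism), and for ANY such attaching maps the semi-graph of profinite groups
`{P_v; Z; b ↦ att_{v, js_v b}}` on `𝔾` is of injective type and its semi-graph of anabelioids is OF
SURFACE TYPE (`isOfSurfaceType_toAnab_of_cuspAttachment`, by the bridge `isOfSurfaceType_toAnab`).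
Unconditionally (`exists_isOfSurfaceType_on`, `SemiGraphOfAnabelioids.exists_isOfSurfaceType_on`): every
semi-graph decorated with hyperbolic types and injective cusp assignments (i.e. with at most `r_v`
branches at `v`) underlies a semi-graph of anabelioids of surface type.  The smooth / nodal / loop
models (`SurfaceTypeModels`, `SurfaceTypeNodalModels`, `SurfaceTypeLoopModels`) are the cases of one
vertex, two vertices and a node, one vertex and a loop.  Finally, Example 2.10 being a theorem of the
tree (`example_2_10_holds`, abc-iut-w5-d195 et al.), its five conclusions — coherent, totally
elevated, totally universally sub-coverticial, totally estranged, verticially slim — hold on every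
decorated semi-graph all of whose edges abut to a vertex (`SemiGraphOfAnabelioids.exists_example_2_10_on`).

A model certifies satisfiability only; nothing here takes a side on [IUTchIII] Cor. 3.12.
Theorems only.
-/

noncomputable section

namespace Literature.AnabelianGeometry.SemiGraphs

open CategoryTheory
open Literature.AnabelianGeometry.Anabelioids
open Literature.GroupTheory.CombinatorialGroupTheory
open scoped Pointwise

universe u

namespace ProfiniteSemiGraph

section CuspData

variable (Sigma : Set ℕ) (𝔾 : SemiGraph.{u}) (g r : 𝔾.Vertex → ℕ)
  (P : 𝔾.Vertex → Type u) [∀ v, Group (P v)] [∀ v, TopologicalSpace (P v)]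
  [∀ v, IsTopologicalGroup (P v)] [∀ v, CompactSpace (P v)] [∀ v, TotallyDisconnectedSpace (P v)]
  (ι : ∀ v, PuncturedSurfaceGroup (g v) (r v) →* P v)
  (Z : Type u) [Group Z] [TopologicalSpace Z] [IsTopologicalGroup Z] [CompactSpace Z]
  [TotallyDisconnectedSpace Z]

/-- **Attaching maps exist**: for pro-`Σ` completions `ι_v : Γ_{g_v,r_v} → P_v` of hyperbolic type and
a pro-`Σ` completion `κ : ℤ → Z`, there are, for every vertex `v` and cusp `j`, injective continuous
homomorphisms `att_{v,j} : Z → P_v` with image EXACTLY the closed cusp inertia group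
`closure ι_v(⟨c_j⟩)` and `att_{v,j}(κ(1)^m) = ι_v(c_j)^m` (`Ī_{v,j}` and `Z` are both pro-`Σ`
completions of `ℤ`, `SurfaceTypeEdgeGroups`). [cite: MochizukiSemiAnbd2006, Ex. 2.10 p.31] -/
theorem exists_cuspAttachment (hgr : ∀ v, PuncturedSurfaceGroup.IsHyperbolicType (g v) (r v))
    (hι : ∀ v, SemiGraphOfAnabelioids.IsProSigmaCompletion Sigma (ι v)) (κ : Multiplicative ℤ →* Z)
    (hκ : SemiGraphOfAnabelioids.IsProSigmaCompletion Sigma κ) :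
    ∃ att : ∀ v, Fin (r v) → (Z →ₜ* P v), ∀ v j, Function.Injective (att v j) ∧
      (att v j).toMonoidHom.range =
        ((PuncturedSurfaceGroup.cuspInertia (g := g v) j).map (ι v)).topologicalClosure ∧
      ∀ m : Multiplicative ℤ, att v j (κ m) = zpowersHom (P v) (ι v (PuncturedSurfaceGroup.c j)) m := by
  let K : ∀ v, Fin (r v) → Subgroup (P v) := fun v j =>
    ((PuncturedSurfaceGroup.cuspInertia (g := g v) j).map (ι v)).topologicalClosure
  haveI hKc : ∀ v j, CompactSpace ↥(K v j) := fun v j =>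
    isCompact_iff_compactSpace.mp (Subgroup.isClosed_topologicalClosure _).isCompact
  have hatt : ∀ v j, ∃ e : Z ≃ₜ* ↥(K v j), ∀ m : Multiplicative ℤ,
      e (κ m) = ((zpowersHom (P v) (ι v (PuncturedSurfaceGroup.c j))).codRestrict (K v j)
        (SemiGraphOfAnabelioids.IsProSigmaCompletion.zpowersHom_mem_cuspInertiaClosure (ι v) j)) m :=
    fun v j => hκ.exists_continuousMulEquiv
      (SemiGraphOfAnabelioids.IsProSigmaCompletion.isProSigmaCompletion_cuspInertiaClosure (hι v)
        (hgr v) j)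
  choose e he using hatt
  refine ⟨fun v j =>
    { toMonoidHom := (K v j).subtype.comp (e v j).toMulEquiv.toMonoidHom
      continuous_toFun := continuous_subtype_val.comp (e v j).continuous }, fun v j => ⟨?_, ?_, ?_⟩⟩
  · exact Subtype.val_injective.comp (e v j).injective
  · change ((K v j).subtype.comp (e v j).toMulEquiv.toMonoidHom).range = _
    rw [MonoidHom.range_comp, MonoidHom.range_eq_top.mpr (e v j).surjective, ← MonoidHom.range_eq_map,
      Subgroup.range_subtype]
  · intro m
    exact congrArg Subtype.val (he v j m)

variable {Sigma 𝔾 g r P ι Z}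

/-- **Surface type from cusp attachments** ([SemiAnbd] Ex. 2.10, combinatorial form): if the `ι_v` are
pro-`Σ` completions of hyperbolic type, `Σ` is a nonempty set of primes, the `js_v` are injective, and
each `att_{v,j} : Z → P_v` is injective with image the closed cusp inertia group `closure ι_v(⟨c_j⟩)`,
then the semi-graph of profinite groups on `𝔾` with vertex groups `P_v`, edge groups `Z` and the
branch `b` at `v` attached by `att_{v, js_v b}` — the dual semi-graph of a pointed stable curve with
components of types `(g_v, r_v)` — is of injective type and its semi-graph of anabelioids
`{B(P_v), B(Z), B(att)}` is of surface type. [cite: MochizukiSemiAnbd2006, Ex. 2.10 p.31] -/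
theorem isOfSurfaceType_toAnab_of_cuspAttachment (hSigma : Sigma.Nonempty ∧ ∀ p ∈ Sigma, p.Prime)
    (hgr : ∀ v, PuncturedSurfaceGroup.IsHyperbolicType (g v) (r v))
    (hι : ∀ v, SemiGraphOfAnabelioids.IsProSigmaCompletion Sigma (ι v))
    (js : ∀ v, 𝔾.Star v → Fin (r v)) (hjs : ∀ v, Function.Injective (js v))
    (att : ∀ v, Fin (r v) → (Z →ₜ* P v)) (hinj : ∀ v j, Function.Injective (att v j))
    (hrange : ∀ v j, (att v j).toMonoidHom.range =
      ((PuncturedSurfaceGroup.cuspInertia (g := g v) j).map (ι v)).topologicalClosure) :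
    ({ graph := 𝔾, Gv := P, Ge := fun _ => Z, brHom := fun b v h => att v (js v ⟨b, h⟩) } :
        ProfiniteSemiGraph.{u}).IsOfInjectiveType ∧
      ({ graph := 𝔾, Gv := P, Ge := fun _ => Z, brHom := fun b v h => att v (js v ⟨b, h⟩) } :
        ProfiniteSemiGraph.{u}).toAnab.IsOfSurfaceType Sigma := by
  have hinj' : ({ graph := 𝔾, Gv := P, Ge := fun _ => Z, brHom := fun b v h => att v (js v ⟨b, h⟩) } :
      ProfiniteSemiGraph.{u}).IsOfInjectiveType := fun b v h => hinj v (js v ⟨b, h⟩)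
  refine ⟨hinj', ProfiniteSemiGraph.isOfSurfaceType_toAnab _ Sigma hSigma hinj' fun v =>
    ⟨g v, r v, ι v, hgr v, hι v, js v, hjs v, fun b => ⟨1, ?_⟩⟩⟩
  rw [map_one, one_smul]
  exact hrange v (js v b)

variable (Sigma 𝔾 g r P ι Z)

/-- **Surface-type structure on an arbitrary decorated semi-graph, over given completions**: with
`ι_v`, `κ` pro-`Σ` completions as above and injective `js_v`, there is a semi-graph of profinite groups
with underlying semi-graph `𝔾`, vertex groups (isomorphic to) `P_v`, edge groups (isomorphic to) `Z`,
of injective type, whose semi-graph of anabelioids is of surface type.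
[cite: MochizukiSemiAnbd2006, Ex. 2.10 p.31] -/
theorem exists_isOfSurfaceType_of_cuspData (hSigma : Sigma.Nonempty ∧ ∀ p ∈ Sigma, p.Prime)
    (hgr : ∀ v, PuncturedSurfaceGroup.IsHyperbolicType (g v) (r v))
    (hι : ∀ v, SemiGraphOfAnabelioids.IsProSigmaCompletion Sigma (ι v)) (κ : Multiplicative ℤ →* Z)
    (hκ : SemiGraphOfAnabelioids.IsProSigmaCompletion Sigma κ)
    (js : ∀ v, 𝔾.Star v → Fin (r v)) (hjs : ∀ v, Function.Injective (js v)) :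
    ∃ 𝔊 : ProfiniteSemiGraph.{u}, 𝔊.graph = 𝔾 ∧
      (∀ v, ∃ w, Nonempty (𝔊.Gv v ≃ₜ* P w)) ∧ (∀ e, Nonempty (𝔊.Ge e ≃ₜ* Z)) ∧
      𝔊.IsOfInjectiveType ∧ 𝔊.toAnab.IsOfSurfaceType Sigma := by
  obtain ⟨att, hatt⟩ := exists_cuspAttachment Sigma 𝔾 g r P ι Z hgr hι κ hκ
  obtain ⟨hinj, hS⟩ := isOfSurfaceType_toAnab_of_cuspAttachment hSigma hgr hι js hjs att
    (fun v j => (hatt v j).1) (fun v j => (hatt v j).2.1)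
  exact ⟨_, rfl, fun v => ⟨v, ⟨ContinuousMulEquiv.refl _⟩⟩, fun e => ⟨ContinuousMulEquiv.refl _⟩,
    hinj, hS⟩

end CuspData

/-- **[SemiAnbd] Example 2.10, combinatorial form, unconditionally**: every semi-graph `𝔾` decorated
with hyperbolic types `(g_v, r_v)` and injective cusp assignments `js_v : {branches at v} ↪ Fin r_v`
underlies a semi-graph of profinite groups of injective type — vertex groups pro-`Σ` completions of the
`Γ_{g_v,r_v}`, edge groups a pro-`Σ` completion of `ℤ`, branches attached onto the closed cusp inertia
groups — whose semi-graph of anabelioids is of surface type (completions exist: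
`IsProSigmaCompletion.exists_isProSigmaCompletion`). [cite: MochizukiSemiAnbd2006, Ex. 2.10 p.31] -/
theorem exists_isOfSurfaceType_on (Sigma : Set ℕ) (hSigma : Sigma.Nonempty ∧ ∀ p ∈ Sigma, p.Prime)
    (𝔾 : SemiGraph.{0}) (g r : 𝔾.Vertex → ℕ)
    (hgr : ∀ v, PuncturedSurfaceGroup.IsHyperbolicType (g v) (r v))
    (js : ∀ v, 𝔾.Star v → Fin (r v)) (hjs : ∀ v, Function.Injective (js v)) :
    ∃ 𝔊 : ProfiniteSemiGraph.{0}, 𝔊.graph = 𝔾 ∧ 𝔊.IsOfInjectiveType ∧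
      (∀ v, ∃ (g' r' : ℕ) (ιv : PuncturedSurfaceGroup g' r' →* 𝔊.Gv v),
        PuncturedSurfaceGroup.IsHyperbolicType g' r' ∧
          SemiGraphOfAnabelioids.IsProSigmaCompletion Sigma ιv) ∧
      (∀ e, ∃ κ : Multiplicative ℤ →* 𝔊.Ge e, SemiGraphOfAnabelioids.IsProSigmaCompletion Sigma κ) ∧
      𝔊.toAnab.IsOfSurfaceType Sigma := by
  have hP : ∀ v, ∃ (Q : ProfiniteGrp.{0}) (ιv : PuncturedSurfaceGroup (g v) (r v) →* Q),
      SemiGraphOfAnabelioids.IsProSigmaCompletion Sigma ιv := fun v =>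
    SemiGraphOfAnabelioids.IsProSigmaCompletion.exists_isProSigmaCompletion _ Sigma
  choose Q ι hι using hP
  obtain ⟨Z, κ, hκ⟩ :=
    SemiGraphOfAnabelioids.IsProSigmaCompletion.exists_isProSigmaCompletion (Multiplicative ℤ) Sigma
  obtain ⟨att, hatt⟩ := exists_cuspAttachment Sigma 𝔾 g r (fun v => Q v) ι Z hgr hι κ hκ
  obtain ⟨hinj, hS⟩ := isOfSurfaceType_toAnab_of_cuspAttachment hSigma hgr hι js hjs att
    (fun v j => (hatt v j).1) (fun v j => (hatt v j).2.1)
  exact ⟨_, rfl, hinj, fun v => ⟨g v, r v, ι v, hgr v, hι v⟩, fun e => ⟨κ, hκ⟩, hS⟩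

end ProfiniteSemiGraph

/-- **Every decorated semi-graph underlies a semi-graph of anabelioids of surface type** (§2
presentation): for every semi-graph `𝔾`, hyperbolic types `(g_v, r_v)` and injective cusp assignments
to the branches at each vertex, there is a semi-graph of anabelioids of surface type with underlying
semi-graph `𝔾` — so it is connected iff `𝔾` is, every edge abuts to a vertex iff this holds in `𝔾`,
and it is a graph of anabelioids iff `𝔾` is a graph ([SemiAnbd] Ex. 2.10, dual semi-graphs of
pointed stable curves, combinatorial form). [cite: MochizukiSemiAnbd2006, Ex. 2.10 p.31] -/
theorem SemiGraphOfAnabelioids.exists_isOfSurfaceType_on (Sigma : Set ℕ)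
    (hSigma : Sigma.Nonempty ∧ ∀ p ∈ Sigma, p.Prime) (𝔾 : SemiGraph.{0}) (g r : 𝔾.Vertex → ℕ)
    (hgr : ∀ v, PuncturedSurfaceGroup.IsHyperbolicType (g v) (r v))
    (js : ∀ v, 𝔾.Star v → Fin (r v)) (hjs : ∀ v, Function.Injective (js v)) :
    ∃ 𝒢 : SemiGraphOfAnabelioids.{0, 1, 0}, 𝒢.graph = 𝔾 ∧ 𝒢.IsOfSurfaceType Sigma ∧
      (𝒢.IsConnected ↔ 𝔾.IsConnected) ∧
      (𝒢.EveryEdgeAbuts ↔ ∀ e : 𝔾.Edge, ∃ v, 𝔾.EdgeAbuts e v) ∧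
      (𝒢.IsGraphOfAnabelioids ↔ 𝔾.IsGraph) := by
  obtain ⟨𝔊, hG, -, -, -, hS⟩ :=
    ProfiniteSemiGraph.exists_isOfSurfaceType_on Sigma hSigma 𝔾 g r hgr js hjs
  subst hG
  refine ⟨𝔊.toAnab, rfl, hS, ⟨fun h => h.1, fun h => ⟨h⟩⟩, ⟨fun h e => ?_, fun h e => ?_⟩,
    ⟨fun h => h.1, fun h => ⟨h⟩⟩⟩
  · obtain ⟨b, v, hb, hv⟩ := h e
    exact ⟨v, b, hb, hv⟩
  · obtain ⟨v, b, hb, hv⟩ := h e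
    exact ⟨b, v, hb, hv⟩

/-- **Example 2.10 realised on every shape**: for every semi-graph `𝔾` all of whose edges abut to a
vertex, hyperbolic types `(g_v, r_v)` and injective cusp assignments, there is a semi-graph of
anabelioids with underlying semi-graph `𝔾` which is of surface type AND coherent, totally elevated,
totally universally sub-coverticial, totally estranged and verticially slim — the model of
`exists_isOfSurfaceType_on` fed to the tree's theorem `example_2_10_holds` ([SemiAnbd] Ex. 2.10).
[cite: MochizukiSemiAnbd2006, Ex. 2.10 p.31] -/
theorem SemiGraphOfAnabelioids.exists_example_2_10_on (Sigma : Set ℕ)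
    (hSigma : Sigma.Nonempty ∧ ∀ p ∈ Sigma, p.Prime) (𝔾 : SemiGraph.{0})
    (hE : ∀ e : 𝔾.Edge, ∃ v, 𝔾.EdgeAbuts e v) (g r : 𝔾.Vertex → ℕ)
    (hgr : ∀ v, PuncturedSurfaceGroup.IsHyperbolicType (g v) (r v))
    (js : ∀ v, 𝔾.Star v → Fin (r v)) (hjs : ∀ v, Function.Injective (js v)) :
    ∃ 𝒢 : SemiGraphOfAnabelioids.{0, 1, 0}, 𝒢.graph = 𝔾 ∧ 𝒢.IsOfSurfaceType Sigma ∧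
      𝒢.IsCoherent ∧ 𝒢.IsTotallyElevated ∧ 𝒢.IsTotallyUniversallySubCoverticial ∧
        𝒢.IsTotallyEstranged ∧ 𝒢.IsVerticiallySlim := by
  obtain ⟨𝒢, hG, hS, -, hEA, -⟩ :=
    SemiGraphOfAnabelioids.exists_isOfSurfaceType_on Sigma hSigma 𝔾 g r hgr js hjs
  exact ⟨𝒢, hG, hS, SemiGraphOfAnabelioids.example_2_10_holds 𝒢 Sigma (hEA.mpr hE) hS⟩

end Literature.AnabelianGeometry.SemiGraphs

end
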